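import Mathlib

/-!
# Typed target: no planar complex four-body absolute equilibrium at the six E₃₂ cluster mass vectors
(venture `CentralConfigurations`, cell `pub-smale6`, seat 2)

HONEST FRAMING (cell brief): closing part of a known exceptional set by certified computer algebra; not a new method.

The deciding polynomial system of the HYBRID tropical test on the Albouy–Kaloshin family `E₃₂ = {m₁ = m₂, m₃ = m₄}`
(HOME/certs/tropical_e32/HYBRID.md, rounds 1–2) is the system of *absolute equilibria* (`λ = 0`, Albouy–Kaloshin 2012
§5.3/§5.5) of a four-body cluster.  This file only TYPES the statement decided OUTSIDE Lean by two independent exact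
implementations — seat 2's elimination in `ℚ(ω)` (code/tropical/cluster_caseA3.py, cluster_caseB.py; logs
certs/tropical_e32/cluster_equilibria_v3_*.txt) and the referee's Gröbner bases over `ℚ`
(certs/cluster_gb_referee/README.md, kit jobs j048395, j048920: Case A 27/27 and Case B 64/64 unit ideals at all six
vectors) — modulo the hand derivation that cases (A) ∪ (B) exhaust the planar absolute equilibria with non-zero signed
distances (checked by the referee, STATUS gen 15).  Nothing here is proved in Lean and nothing here is a Literature fact.
Encoding: positions `q i ∈ K²` over any field of characteristic zero, the standard bilinear form, and *signed
distances* `r i j ∈ K` with `r i j ^ 2 = ‖q i - q j‖²_bil`, `r i j ≠ 0` (torus condition), `r i j = r j i`.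

Provenance: port of the cell's staged `HOME/lean/Smale6N5ClusterEquilibria.lean` (rc 0, referee gen 96), namespace
`Smale6N5` ↦ `Summit.Ventures.CentralConfigurations`; `ClusterTargets` now lists all SIX decided vectors (the staged
file listed four of the six named in its own docstring).
-/

namespace Summit.Ventures.CentralConfigurations

open Finset

/-- `IsSignedDistanceData q r`: `r` is a symmetric choice of square roots of the bilinear
"squared distances" of the configuration `q : Fin 4 → (Fin 2 → K)`, all non-zero. -/
def IsSignedDistanceData {K : Type*} [Field K] (q : Fin 4 → Fin 2 → K)
    (r : Fin 4 → Fin 4 → K) : Prop :=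
  ∀ i j : Fin 4, i ≠ j →
    r i j ≠ 0 ∧ r i j = r j i ∧ r i j ^ 2 = ∑ c : Fin 2, (q i c - q j c) ^ 2

/-- The absolute-equilibrium equations `∑_{k ≠ i} m_k r_{ik}^{-3} (q_k - q_i) = 0` for every body `i`
(Newtonian attraction with zero multiplier: `λ = 0`). -/
def IsAbsoluteEquilibrium {K : Type*} [Field K] (m : Fin 4 → K) (q : Fin 4 → Fin 2 → K)
    (r : Fin 4 → Fin 4 → K) : Prop :=
  ∀ i : Fin 4, ∀ c : Fin 2,
    ∑ k ∈ (univ : Finset (Fin 4)).filter (· ≠ i), m k / r i k ^ 3 * (q k c - q i c) = 0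

/-- `NoPlanarAbsoluteEquilibrium4 m`: for the rational mass vector `m` there is no planar complex
four-body absolute equilibrium with non-zero signed mutual distances, over any field of
characteristic zero. Decided (outside Lean, not kernel-checked) for the six vectors `m = (2,3,3,5), (3,7,7,11),
(2,2,3,5), (2,2,3,3), (3,3,7,11), (3,3,7,7)` by two independent exact implementations of the reduced case split
(A) 27 cube-root branches / (B) 64 collinear sign patterns — seat 2's elimination in `ℚ(ω)`
(certs/tropical_e32/cluster_equilibria_v3_*.txt) and the referee's Gröbner bases over `ℚ`, unit ideal throughout
(certs/cluster_gb_referee/README.md, jobs j048395, j048920); the exhaustiveness of (A) ∪ (B) is a hand derivation. -/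
def NoPlanarAbsoluteEquilibrium4 (m : Fin 4 → ℚ) : Prop :=
  ∀ (K : Type) [Field K] [CharZero K] (q : Fin 4 → Fin 2 → K) (r : Fin 4 → Fin 4 → K),
    IsSignedDistanceData q r → ¬ IsAbsoluteEquilibrium (fun i => (m i : K)) q r

/-- The six computed instances (targets, not theorems): the 4-cluster types of the E₃₂ points `(2,2,3,3,5)` and
`(3,3,7,7,11)` — exactly the list of certs/tropical_e32/HYBRID.md and certs/cluster_gb_referee/README.md. -/
def ClusterTargets : Prop :=
  NoPlanarAbsoluteEquilibrium4 ![2, 3, 3, 5] ∧ NoPlanarAbsoluteEquilibrium4 ![3, 7, 7, 11] ∧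
  NoPlanarAbsoluteEquilibrium4 ![2, 2, 3, 5] ∧ NoPlanarAbsoluteEquilibrium4 ![2, 2, 3, 3] ∧
  NoPlanarAbsoluteEquilibrium4 ![3, 3, 7, 11] ∧ NoPlanarAbsoluteEquilibrium4 ![3, 3, 7, 7]

/-- Sanity `example`: the definitions elaborate on a concrete instance (no mathematical content). -/
example : NoPlanarAbsoluteEquilibrium4 ![2, 3, 3, 5] → ClusterTargets → True := fun _ _ => trivial

end Summit.Ventures.CentralConfigurations
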